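import Literature.MathematicalPhysics.QuantumFieldTheory.Balaban1983to89.B9Eq3130TransferPairLetters
import Literature.MathematicalPhysics.QuantumFieldTheory.Balaban1983to89.B9Eq325RofUkSupRowClosed
import Literature.MathematicalPhysics.QuantumFieldTheory.Balaban1983to89.B9Eq326G1kDivergenceRowClosed
import Literature.MathematicalPhysics.QuantumFieldTheory.Balaban1983to89.B9Eq3117GaugeModeStencilLettersTower

/-!
# `Balaban1983to89.B9Eq3130GtildePairRowsClosed` — T. Bałaban, *Propagators for lattice gauge theories in a background field*, Commun. Math. Phys. **99** (1985) 389–434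
# [Balaban1985BackgroundPropagators] (3.130) p. 421 (*«G = G₀(I − Δ′_πG₀)⁻¹»*), (3.117)–(3.120) p. 419, (3.36) p. 396, (3.152) p. 426, Thm 3.1 (3.42) p. 397, Thm 3.3 p. 399,
# p. 422 l. 1–6 (*«This inequality and Theorem 3.3 for G₀ imply a convergence of the series (3.130), for α₀ sufficiently small, in all norms … except the inequality involving
# the Laplace operator»*): **THE TOWER END OF THE PAIR BOOTSTRAP — THE VALUE ROW AND THE DIVERGENCE ROW OF ANY `G̃` SATISFYING THE GAUGE-SPLIT IDENTITIES TRANSFER FROM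
# `G1k`, ∃-FIRST, HEIGHT-FREE, under print's third window `‖J‖ ≤ j₁` and print's weight `c₀ = η^d`** — PLAN v15 (b) (R-ne9p1-g97-1, journal `HOME/CLAIMS.log` l.65987) on
# the cell's MODEL: (K72) `transfer_pair` instantiated at `towerP L m (n+1)` with the landed rows (K64), (DGK), (K76a), (K70) and the two stencil letters (K75); the three
# identities `hT`, `h2`, `h3` (the OWNER's INTENT-3 `B9Eq3130GaugeSplitTower`, for `G̃ := laplaceAkPi⁻¹`) are DISPLAYED HYPOTHESES here, so the END holds for EVERY `G̃`
# satisfying them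

statement-level skeleton of published theorems with citation tags; proofs where landed; nothing here is a claim about the Yang–Mills mass gap

CITATION HEADER (lean-in-tree rule).  Audit cell `pub-balaban`, sub-cell `t4`, BINDER row NE9; filed by NE9 crux-team LEAF PROVER 05
(`b2b-balaban-t4-ne9-formalise-leaf-05`, gen 88; MINE on the END, A-1 (5), journal l.66167).  Composed BY NAME: (K72) `B9Eq3130TransferPairLetters.transfer_pair` (this lineage,
gen 88), (K64) `B9Eq326G1kSupRowClosed.exists_local_letter_G1k` (leaf-05 g87), (DGK) `B9Eq326G1kDivergenceRowClosed.exists_divergence_row_G1k` (ne9-leaf-03 g79), (K76a)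
`B9Eq325RofUkSupRowClosed.exists_local_letters_GpOfUk_RofUk`, (K70) `B9Eq3152GreenPrimeProjGradRowClosed.exists_local_gradLetter_GpRk`, (K75)
`B9Eq3117GaugeModeStencilLettersTower.local_hessOp_covDerivL2K_tower` ∕ `local_covDivL2K_hessOp_tower` (on the OWNER t4-ne9-p1 g97's `B9Eq3117HessOpGaugeMode` ∕
`B9Eq3117DivHessOpGaugeMode`), ne9-leaf-03's `tdist_bigBlock_bpos_btgt_le_one`, `B4Sect5Torus.torusSum_le`; [folklore] real bookkeeping.  Source READ first-hand this
generation (`paper:balaban1985-cmp99-background-propagators`, journal page = PDF page + 388): pp. 392, 396–399, 418–422, 426.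

WHAT IS PROVED (sorry-free; proof lane — no `def`).  **`exists_local_letters_pair_of_gaugeSplit`** — `∃ (α₁, j₁, B, δ)` with `0 < α₁`, `0 < j₁`, `0 ≤ B`, `0 < δ` BEFORE the
(K64) binder block (verbatim: E162's data, the windows, `hRlev`, `hpos′`, `hpos`) + `c₀ = η^d` + the current window `‖J(b)‖ ≤ j₀ ≤ j₁` + ANY continuous linear `G̃` on the bond
space with the three identities `hT` (the resolvent identity, `Δ′_π = −M∘P − D_UR_kG′_k∘M†∘π` expanded, `M = Δ^η(U)∘D_U`, `M† = D*_U∘Δ^η(U)`), `h2` (`G1k(D_U(R_ks)) =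
D_U(G′_k(R_ks)) − G1k(M(G′_k(R_ks)))`), `h3` (`D*_U(D_U(G′_k(R_ks))) = R_ks`), such that for every coarse block `v`, every bond field `f` supported over `Π⁻¹(v)` (`Π∘b₋`)
with `‖f‖_∞ ≤ F`: **`‖(G̃f)(b)‖ ≤ B·e^{−δ·d_m(Π(b₋), v)}·F`** and **`‖(D*_UG̃f)(y)‖ ≤ B·e^{−δ·d_m(Πy, v)}·F`** — `δ = κ∕2`, `κ = min` of the four suppliers' rates, `B = 2·max(B_K64,
B_DGK)`, `j₁ = min(1, 1∕(2S))` with `S` the sum of the `j₀`-coefficients of (K72)'s `q₁`, `q₂` (every summand of `q_i` carries `ε₁ = 2M_φM_φ′j₀e^κ` or `ε₂ = 2dM_φM_φ′j₀e^κ`,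
so `q_i = j₀A_i + j₀²A′_i ≤ 1∕2`).
HONEST SCOPE.  [folklore] assembly; `hT`∕`h2`∕`h3`, (g2), `hpos′`, `hpos`, the windows, E162's data, `c₀ = η^d` and `‖J‖ ≤ j₀` stay HYPOTHESES (for `G̃ := laplaceAkPi⁻¹` the
identities are the OWNER's INTENT-3; `‖J‖ ≤ j₀` is (3.36)); constants crude; nothing of [B9] (3.36) ∕ (3.130)–(3.133) ∕ Thm 3.1 ∕ 3.3 ∕ 3.13 or [B11] (117) asserted, valued or
discharged; «NE9 ⇐ the named binders»; NE9 NOT PRINTED ∕ NOT PROVED; row WALLED ON A MODEL (O-NE9-1; #5 UNRULED); spine PROVED 0∕9; rung (B)+1 on a finite T⁴ — NOT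
infinite volume, NOT mass gap, NOT BetaPertH, NOT Clay.  HONEST DEPENDENCY: continuum YM on T⁴ ⇐ BetaPertH ∧ nine spine estimates (0/9 proved); BetaPertH ⇐ (D1) ∧ (D4) ∧
CAP+tail; G-an2-4 gates asym, D1 and NE2/3/4.  NEW file importing four modules ((K72), (K76a), (DGK), (K75)); nothing modified.  Net new unproved facts: 0.
-/

noncomputable section

set_option autoImplicit false

open scoped InnerProductSpace ComplexConjugate BigOperators

namespace Literature.MathematicalPhysics.QuantumFieldTheory.Balaban1983to89.B9Eq3130GtildePairRowsClosed

open B4Sect5Torus (TSite tdist tdist_nonneg tdist_symm tdist_self tdist_triangle torusSum_le)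
open B4Sect5Proof (latticeConst latticeConst_nonneg)
open B9SectCLatticeCarrier (Bond DirPair bpos btgt shift unshift)
open B9Eq311L2Pairing (WL2)
open B9Eq319QprimeTorus (fineP blockCoord)
open B7Prop1Explicit (U1 Wcx boxVec)
open B11Eq103H1Complex (SiteL2K BondL2K greenK covDerivL2K covDivL2K)
open B9Eq310DeltaPrime (plaqHolU)
open B9Eq310HessianOperator (adTransportW hessOp)
open B9Eq310HessianHermitian (adTransportW_adjoint)
open B9Eq315QTorus (perCfg cornerSite)
open B9Eq315QTower (towerP UlevOf)
open B9Eq316TowerFlatIsOneStep (towerP_eq_fineP_pow siteCast)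
open B9Eq326OperatorTower (QprimeTowerW RofUk laplaceAk G1k)
open B9Eq324DeltaPrimeATower (laplacePrimeAk GpOfUk)
open B9Eq33CovDerivLocalLetterTower (tdist_bigBlock_bpos_btgt_le_one)
open B9Eq326G1kSupRowClosed (exists_local_letter_G1k)
open B9Eq326G1kDivergenceRowClosed (exists_divergence_row_G1k)
open B9Eq325RofUkSupRowClosed (exists_local_letters_GpOfUk_RofUk)
open B9Eq3152GreenPrimeProjGradRowClosed (exists_local_gradLetter_GpRk)
open B9Eq3117GaugeModeStencilLettersTower (local_hessOp_covDerivL2K_tower local_covDivL2K_hessOp_tower)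
open B9Eq3130TransferPairLetters (transfer_pair)

variable {d : ℕ} (hd : 1 ≤ d) (L : ℕ) [NeZero L] (hL : 1 ≤ L) (hL3 : 3 ≤ L)
  {𝔸 : Type*} [NormedRing 𝔸] [NormedAlgebra ℂ 𝔸] [CompleteSpace 𝔸] [NormOneClass 𝔸] [StarRing 𝔸] [NormedStarGroup 𝔸] [StarModule ℂ 𝔸]
  {W : Type*} [NormedAddCommGroup W] [InnerProductSpace ℂ W] [FiniteDimensional ℂ W] (φ : W ≃ₗ[ℂ] 𝔸)
  {Mφ Mφ' : ℝ} (hMφ : 0 ≤ Mφ) (hMφ' : 0 ≤ Mφ') (hφ : ∀ w, ‖φ w‖ ≤ Mφ * ‖w‖) (hφ' : ∀ X, ‖φ.symm X‖ ≤ Mφ' * ‖X‖) (hstar : ∀ X : 𝔸, ‖star X‖ ≤ ‖X‖)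
  {a : ℝ} (ha : 0 < a) {a' : ℝ} (ha' : 0 < a') {ϱ : ℝ} (hϱ0 : 0 ≤ ϱ) (hϱ1 : ϱ < 1)
  (τ : 𝔸 →ₗ[ℂ] ℂ) {Cτ : ℝ} (hτ : ∀ X, ‖τ X‖ ≤ Cτ * ‖X‖) (hCτ : 0 ≤ Cτ) {Mτ : ℝ} (hτm : ∀ X Y : 𝔸, ‖τ (X * Y)‖ ≤ Mτ * ‖X‖ * ‖Y‖) (hMτ : 0 ≤ Mτ)
  {ρw : ℝ} (hρw : 0 ≤ ρw)
  (hτ₁ : ∀ X : 𝔸, τ (star X) = conj (τ X)) (hτ₂ : ∀ X Y : 𝔸, τ (X * Y) = τ (Y * X)) (hφτ : ∀ X Y : 𝔸, ⟪φ.symm X, φ.symm Y⟫_ℂ = τ (star X * Y))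
  (AQ : ℝ)

omit [NeZero L] in
/-- `e^{−r t} ≤ e^{−κ t}` for `κ ≤ r`, `0 ≤ t`. [folklore] -/
private theorem exp_weaken' {r κ t : ℝ} (hκ : κ ≤ r) (ht : 0 ≤ t) : Real.exp (-(r * t)) ≤ Real.exp (-(κ * t)) :=
  Real.exp_le_exp.2 (by nlinarith)

omit [NeZero L] in
/-- `e^{−κ t′} ≤ e^{κ}·e^{−κ t}` when `t ≤ t′ + 1`, `0 ≤ κ` (a gradient row read at the bond's tip block is read at its base block). [folklore] -/
private theorem exp_reblock {κ t t' : ℝ} (hκ : 0 ≤ κ) (h : t ≤ t' + 1) : Real.exp (-(κ * t')) ≤ Real.exp κ * Real.exp (-(κ * t)) := by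
  rw [← Real.exp_add]
  exact Real.exp_le_exp.2 (by nlinarith [mul_le_mul_of_nonneg_left h hκ])

set_option maxHeartbeats 400000 in
include hd hL hL3 hMφ hMφ' hφ hφ' hstar ha ha' hϱ0 hϱ1 hτ hCτ hτm hMτ hρw hτ₁ hτ₂ hφτ in
/-- **THE TOWER END OF THE PAIR BOOTSTRAP, MODULO THE GAUGE-SPLIT IDENTITIES.**  For ANY continuous linear `G̃` on the bond space of the tower satisfying `hT` (the
resolvent identity around `G1k` with `Δ′_π = −(Δ∘D_U)∘G′_kR_kD*_U − D_UR_kG′_k∘(D*_U∘Δ)∘π_k` expanded), `h2` (the left gauge mode exchanged) and `h3`, under the (K64) binder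
block, print's weight `c₀ = η^d` and print's third window `‖J‖ ≤ j₀ ≤ j₁`: the VALUE row and the DIVERGENCE row of `G̃` carry (L)-letters with the SAME height-free `(B, δ)`
— (K72) `transfer_pair` with `G₀ := G1k` (K64), `D*∘G₀ :=` (DGK), `G′ := G′_k`, `R := R_k` (K76a), `D∘G′∘R :=` (K70) read at the base block, `M`, `M†` := (K75)'s stencil
letters (`ε₁ = 2M_φM_φ′j₀e^κ`, `ε₂ = 2dM_φM_φ′j₀e^κ`), so that `q₁, q₂ ≤ 1∕2` once `j₀ ≤ j₁`. [cite: Balaban1985BackgroundPropagators, (3.130) p.421, (3.117) p.419, (3.36) p.396,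
(3.152) p.426, Thm 3.1 (3.42) p.397, Thm 3.3 p.399] [cite: Balaban1984PropagatorsII, Lemma 2.1 (2.61) p.234] -/
theorem exists_local_letters_pair_of_gaugeSplit :
    ∃ α₁ j₁ B δ : ℝ, 0 < α₁ ∧ 0 < j₁ ∧ 0 ≤ B ∧ 0 < δ ∧
      ∀ (n : ℕ) (η : ℝ) (_hηL : η * (L : ℝ) ^ (n + 1) = 1) (c₀ c₁ : ℝ) [Fact (0 < c₀)] [Fact (0 < c₁)]
        (_hw : c₀ * ((L : ℝ) ^ (n + 1)) ^ d = c₁) (_hρ : |η| ^ d / c₀ ≤ ρw) (m : Fin d → ℕ) [∀ i, NeZero (m i)] (_hm : ∀ i, 1 ≤ m i)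
        (U : Bond d (towerP L m (n + 1)) → 𝔸ˣ) (αU : ℕ → ℝ) (_hα0 : ∀ j, 0 ≤ αU j) (hα1 : ∀ j, αU j ≤ 1 / 64)
        (hU1 : ∀ (j : ℕ) (x : B7Prop1Explicit.Site d) (k : Fin d), perCfg (towerP L m (j + 1)) (UlevOf L m (n + 1) U j) x k ∈ U1 𝔸)
        (hreg : ∀ (j : ℕ) (y : TSite d (towerP L m j)) (k : Fin d) (ρ' : Fin d → Fin L),
          ‖((Wcx L (perCfg (towerP L m (j + 1)) (UlevOf L m (n + 1) U j)) (cornerSite L y) k (boxVec L ρ') : 𝔸ˣ) : 𝔸) - 1‖ ≤ αU j)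
        (εU : ℕ → ℝ) (_hεU : ∀ j, 0 ≤ εU j) (_hUε : ∀ (j : ℕ) (b : Bond d (towerP L m (j + 1))), ‖(UlevOf L m (n + 1) U j b : 𝔸) - 1‖ ≤ εU j)
        (_hLb : ∀ (j : ℕ) (b : Bond d (towerP L m (j + 1))), UlevOf L m (n + 1) U j b ∈ U1 𝔸)
        (α : ℝ) (_hα : 0 ≤ α) (_hαle : α ≤ α₁)
        (hUst : ∀ b, star (U b : 𝔸) = (((U b)⁻¹ : 𝔸ˣ) : 𝔸)) (_hUb : ∀ b, U b ∈ U1 𝔸) (_hUη : ∀ b, ‖(U b : 𝔸) - 1‖ ≤ α * η)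
        (_hpl : ∀ p : B9SectCLatticeCarrier.Plaq d (towerP L m (n + 1)), ‖(plaqHolU U p : 𝔸) - 1‖ ≤ α * η ^ 2)
        (_hUgrad : ∀ (x : TSite d (towerP L m (n + 1))) (μ : Fin d), ‖(U (x, μ) : 𝔸) - U (unshift μ x, μ)‖ ≤ α * η ^ 2)
        (_hRlev : ∀ (j : ℕ) (b : Bond d (towerP L m (j + 1))) (w : W), ‖adTransportW φ (UlevOf L m (n + 1) U j) b w‖ ≤ ‖w‖)
        (_hεg : ∀ j < n + 1, εU j ≤ α * ϱ ^ j) (_hAQ : ∑ j ∈ Finset.range (n + 1), αU j ≤ AQ)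
        (hpos' : ∀ x : SiteL2K ℂ d (towerP L m (n + 1)) c₀ W, x ≠ 0 → 0 < RCLike.re ⟪x, laplacePrimeAk L m n φ η U a' (c₁ := c₁) x⟫_ℂ)
        (hpos : ∀ x : BondL2K ℂ d (towerP L m (n + 1)) c₀ W, x ≠ 0 →
          0 < RCLike.re ⟪x, laplaceAk L m n φ η U hL αU hα1 hU1 hreg τ (c₀ := c₀) (c₁ := c₁) a x⟫_ℂ)
        (_hc₀η : c₀ = η ^ d) (j₀ : ℝ) (_hJ : ∀ μ y, ‖B9Eq39Adjoint.J (fun μ => B9Eq33CovDerivVector.shiftEquiv μ) (fun μ y => U (y, μ)) η μ y‖ ≤ j₀) (_hj : j₀ ≤ j₁)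
        (Gt : BondL2K ℂ d (towerP L m (n + 1)) c₀ W →L[ℂ] BondL2K ℂ d (towerP L m (n + 1)) c₀ W)
        (_hT : ∀ g, Gt g = G1k L m n φ η U hL αU hα1 hU1 hreg τ (c₀ := c₀) (c₁ := c₁) hpos g
          + G1k L m n φ η U hL αU hα1 hU1 hreg τ (c₀ := c₀) (c₁ := c₁) hpos (hessOp φ η U τ (covDerivL2K ℂ c₀ ((η : ℂ))⁻¹ (adTransportW φ U)
              (GpOfUk L m n φ η U a' (c₁ := c₁) hpos' (RofUk L m n φ η U (c₀ := c₀)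
                (covDivL2K ℂ c₀ ((η : ℂ))⁻¹ (adTransportW φ fun bb => (U bb)⁻¹) (Gt g))))))
          + G1k L m n φ η U hL αU hα1 hU1 hreg τ (c₀ := c₀) (c₁ := c₁) hpos (covDerivL2K ℂ c₀ ((η : ℂ))⁻¹ (adTransportW φ U) (RofUk L m n φ η U (c₀ := c₀)
              (GpOfUk L m n φ η U a' (c₁ := c₁) hpos' (covDivL2K ℂ c₀ ((η : ℂ))⁻¹ (adTransportW φ fun bb => (U bb)⁻¹) (hessOp φ η U τ
                (Gt g - covDerivL2K ℂ c₀ ((η : ℂ))⁻¹ (adTransportW φ U) (GpOfUk L m n φ η U a' (c₁ := c₁) hpos'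
                  (RofUk L m n φ η U (c₀ := c₀) (covDivL2K ℂ c₀ ((η : ℂ))⁻¹ (adTransportW φ fun bb => (U bb)⁻¹) (Gt g)))))))))))
        (_h2 : ∀ s, G1k L m n φ η U hL αU hα1 hU1 hreg τ (c₀ := c₀) (c₁ := c₁) hpos (covDerivL2K ℂ c₀ ((η : ℂ))⁻¹ (adTransportW φ U) (RofUk L m n φ η U (c₀ := c₀) s))
          = covDerivL2K ℂ c₀ ((η : ℂ))⁻¹ (adTransportW φ U) (GpOfUk L m n φ η U a' (c₁ := c₁) hpos' (RofUk L m n φ η U (c₀ := c₀) s))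
            - G1k L m n φ η U hL αU hα1 hU1 hreg τ (c₀ := c₀) (c₁ := c₁) hpos (hessOp φ η U τ (covDerivL2K ℂ c₀ ((η : ℂ))⁻¹ (adTransportW φ U)
                (GpOfUk L m n φ η U a' (c₁ := c₁) hpos' (RofUk L m n φ η U (c₀ := c₀) s)))))
        (_h3 : ∀ s, covDivL2K ℂ c₀ ((η : ℂ))⁻¹ (adTransportW φ fun bb => (U bb)⁻¹) (covDerivL2K ℂ c₀ ((η : ℂ))⁻¹ (adTransportW φ U)
          (GpOfUk L m n φ η U a' (c₁ := c₁) hpos' (RofUk L m n φ η U (c₀ := c₀) s))) = RofUk L m n φ η U (c₀ := c₀) s)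
        (v : TSite d m) (f : BondL2K ℂ d (towerP L m (n + 1)) c₀ W) (F : ℝ)
        (_hfv : ∀ b, blockCoord (L ^ (n + 1)) m (siteCast (towerP_eq_fineP_pow L m (n + 1)) (bpos b)) ≠ v →
          WL2.equiv ℂ (fun _ : Bond d (towerP L m (n + 1)) => c₀) W f b = 0)
        (_hfF : ∀ b, ‖WL2.equiv ℂ (fun _ : Bond d (towerP L m (n + 1)) => c₀) W f b‖ ≤ F) (b : Bond d (towerP L m (n + 1))) (y : TSite d (towerP L m (n + 1))),
        ‖WL2.equiv ℂ (fun _ : Bond d (towerP L m (n + 1)) => c₀) W (Gt f) b‖ ≤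
            B * Real.exp (-(δ * tdist m (blockCoord (L ^ (n + 1)) m (siteCast (towerP_eq_fineP_pow L m (n + 1)) (bpos b))) v)) * F ∧
          ‖WL2.equiv ℂ (fun _ : TSite d (towerP L m (n + 1)) => c₀) W (covDivL2K ℂ c₀ ((η : ℂ))⁻¹ (adTransportW φ fun bb => (U bb)⁻¹) (Gt f)) y‖ ≤
            B * Real.exp (-(δ * tdist m (blockCoord (L ^ (n + 1)) m (siteCast (towerP_eq_fineP_pow L m (n + 1)) y)) v)) * F := by  classical
  obtain ⟨αK, BK, δK, hαK, hBK, hδK, HK⟩ :=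
    exists_local_letter_G1k hd L hL hL3 φ hMφ hMφ' hφ hφ' hstar ha ha' hϱ0 hϱ1 τ hτ hCτ hτm hMτ hρw hτ₁ hτ₂ hφτ AQ
  obtain ⟨αG, BG1, δG, hαG, hBG1, hδG, HG⟩ :=
    exists_divergence_row_G1k hd L hL hL3 φ hMφ hMφ' hφ hφ' hstar ha ha' hϱ0 hϱ1 τ hτ hCτ hτm hMτ hρw hτ₁ hτ₂ hφτ AQ
  obtain ⟨αR, BR, δR, hαR, hBR, hδR, HR⟩ :=
    exists_local_letters_GpOfUk_RofUk hd L hL hL3 φ hMφ hMφ' hφ hφ' ha ha' hϱ0 hϱ1 τ hτ hCτ hMτ hρw hτ₁ hτ₂ hφτ AQ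
  obtain ⟨αD, BD, δD, hαD, hBD, hδD, HD⟩ :=
    exists_local_gradLetter_GpRk hd L hL hL3 φ hMφ hMφ' hφ hφ' ha ha' hϱ0 hϱ1 τ hτ hCτ hMτ hρw hτ₁ hτ₂ hφτ AQ
  -- the common rate, the row constant, the `j₀`-free letters of the stencils, the re-blocked gradient constant
  obtain ⟨κ, hκdef⟩ : ∃ κ : ℝ, κ = min (min δK δG) (min δR δD) := ⟨_, rfl⟩
  have hκ0 : 0 < κ := by rw [hκdef]; exact lt_min (lt_min hδK hδG) (lt_min hδR hδD)
  have hκK : κ ≤ δK := by rw [hκdef]; exact (min_le_left _ _).trans (min_le_left _ _)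
  have hκG : κ ≤ δG := by rw [hκdef]; exact (min_le_left _ _).trans (min_le_right _ _)
  have hκR : κ ≤ δR := by rw [hκdef]; exact (min_le_right _ _).trans (min_le_left _ _)
  have hκD : κ ≤ δD := by rw [hκdef]; exact (min_le_right _ _).trans (min_le_right _ _)
  obtain ⟨K, hKdef⟩ : ∃ K : ℝ, K = latticeConst d (κ - κ / 2) := ⟨_, rfl⟩
  have hK0 : 0 ≤ K := by rw [hKdef]; exact latticeConst_nonneg d (sub_pos.2 (half_lt_self hκ0)).le
  obtain ⟨e1, he1⟩ : ∃ e1 : ℝ, e1 = 2 * Mφ * Mφ' * Real.exp κ := ⟨_, rfl⟩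
  obtain ⟨e2, he2⟩ : ∃ e2 : ℝ, e2 = 2 * (d : ℝ) * Mφ * Mφ' * Real.exp κ := ⟨_, rfl⟩
  have he1_0 : 0 ≤ e1 := by rw [he1]; positivity
  have he2_0 : 0 ≤ e2 := by rw [he2]; positivity
  obtain ⟨BDb, hBDb⟩ : ∃ BDb : ℝ, BDb = BD * Real.exp κ := ⟨_, rfl⟩
  have hBDb0 : 0 ≤ BDb := by rw [hBDb]; positivity
  -- the `j₀`-coefficients of (K72)'s contraction factors
  obtain ⟨A₁, hA₁⟩ : ∃ A₁ : ℝ, A₁ = BR * K * BR * K * e1 * K * BK * K + e2 * K * BR * K * BDb * K + BDb * K * e2 * K * BR * K * BDb * K := ⟨_, rfl⟩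
  obtain ⟨A₂, hA₂⟩ : ∃ A₂ : ℝ, A₂ = e2 * K * BR * K * BR * K * BR * K * e1 * K * BK * K + BDb * K * e2 * K * BR * K * BR * K * BR * K * e1 * K * BK * K :=
    ⟨_, rfl⟩
  obtain ⟨A₃, hA₃⟩ : ∃ A₃ : ℝ, A₃ = BR * K * BR * K * e1 * K * BG1 * K + e2 * K * BR * K * BR * K + BDb * K * e2 * K * BR * K * BR * K := ⟨_, rfl⟩
  obtain ⟨A₄, hA₄⟩ : ∃ A₄ : ℝ, A₄ = e2 * K * BR * K * BR * K * BR * K * e1 * K * BG1 * K + BDb * K * e2 * K * BR * K * BR * K * BR * K * e1 * K * BG1 * K :=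
    ⟨_, rfl⟩
  have hA₁0 : 0 ≤ A₁ := by rw [hA₁]; positivity
  have hA₂0 : 0 ≤ A₂ := by rw [hA₂]; positivity
  have hA₃0 : 0 ≤ A₃ := by rw [hA₃]; positivity
  have hA₄0 : 0 ≤ A₄ := by rw [hA₄]; positivity
  obtain ⟨S, hS⟩ : ∃ S : ℝ, S = A₁ + A₂ + A₃ + A₄ + 1 := ⟨_, rfl⟩
  have hS0 : 0 < S := by rw [hS]; positivity
  obtain ⟨j₁, hj₁⟩ : ∃ j₁ : ℝ, j₁ = min 1 (1 / (2 * S)) := ⟨_, rfl⟩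
  have hj₁0 : 0 < j₁ := by rw [hj₁]; exact lt_min one_pos (by positivity)
  have hj₁1 : j₁ ≤ 1 := by rw [hj₁]; exact min_le_left _ _
  have hj₁S : j₁ * S ≤ 1 / 2 := by
    have h : j₁ ≤ 1 / (2 * S) := by rw [hj₁]; exact min_le_right _ _
    calc j₁ * S ≤ 1 / (2 * S) * S := mul_le_mul_of_nonneg_right h hS0.le
      _ = 1 / 2 := by field_simp
  obtain ⟨αs, hαs⟩ : ∃ αs : ℝ, αs = min (min αK αG) (min αR αD) := ⟨_, rfl⟩
  have hαs0 : 0 < αs := by rw [hαs]; exact lt_min (lt_min hαK hαG) (lt_min hαR hαD)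
  refine ⟨αs, j₁, 2 * max BK BG1, κ / 2, hαs0, hj₁0, mul_nonneg zero_le_two (hBK.trans (le_max_left _ _)), half_pos hκ0, ?_⟩
  intro n η hηL c₀ c₁ _ _ hw hρ m _ hm U αU hα0 hα1 hU1 hreg εU hεU hUε hLb α hα hαle hUst hUb hUη hpl hUgrad hRlev hεg hAQ hpos' hpos hc₀η j₀ hJ hj
    Gt hT h2 h3 v f F hfv hfF b y
  haveI : Nonempty (Bond d (towerP L m (n + 1))) := ⟨b⟩
  have hF0 : 0 ≤ F := (norm_nonneg _).trans (hfF b)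
  have hη : η ≠ 0 := by
    intro h0; rw [h0, zero_mul] at hηL; exact zero_ne_one hηL
  have hj₀0 : 0 ≤ j₀ := (norm_nonneg _).trans (hJ b.2 b.1)
  have hj₀1 : j₀ ≤ 1 := hj.trans hj₁1
  have hαK_ : α ≤ αK := hαle.trans (by rw [hαs]; exact (min_le_left _ _).trans (min_le_left _ _))
  have hαG_ : α ≤ αG := hαle.trans (by rw [hαs]; exact (min_le_left _ _).trans (min_le_right _ _))
  have hαR_ : α ≤ αR := hαle.trans (by rw [hαs]; exact (min_le_right _ _).trans (min_le_left _ _))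
  have hαD_ : α ≤ αD := hαle.trans (by rw [hαs]; exact (min_le_right _ _).trans (min_le_right _ _))
  -- the eight operators as continuous linear maps
  obtain ⟨G0cl, hG0cl⟩ : ∃ T : BondL2K ℂ d (towerP L m (n + 1)) c₀ W →L[ℂ] BondL2K ℂ d (towerP L m (n + 1)) c₀ W,
      T = LinearMap.toContinuousLinearMap (G1k L m n φ η U hL αU hα1 hU1 hreg τ (c₀ := c₀) (c₁ := c₁) hpos) := ⟨_, rfl⟩
  obtain ⟨Dcl, hDcl⟩ : ∃ T : SiteL2K ℂ d (towerP L m (n + 1)) c₀ W →L[ℂ] BondL2K ℂ d (towerP L m (n + 1)) c₀ W,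
      T = LinearMap.toContinuousLinearMap (covDerivL2K ℂ c₀ ((η : ℂ))⁻¹ (adTransportW φ U)) := ⟨_, rfl⟩
  obtain ⟨Dscl, hDscl⟩ : ∃ T : BondL2K ℂ d (towerP L m (n + 1)) c₀ W →L[ℂ] SiteL2K ℂ d (towerP L m (n + 1)) c₀ W,
      T = LinearMap.toContinuousLinearMap (covDivL2K ℂ c₀ ((η : ℂ))⁻¹ (adTransportW φ fun bb => (U bb)⁻¹)) := ⟨_, rfl⟩
  obtain ⟨Mcl, hMcl⟩ : ∃ T : SiteL2K ℂ d (towerP L m (n + 1)) c₀ W →L[ℂ] BondL2K ℂ d (towerP L m (n + 1)) c₀ W,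
      T = LinearMap.toContinuousLinearMap (hessOp φ η U τ ∘ₗ covDerivL2K ℂ c₀ ((η : ℂ))⁻¹ (adTransportW φ U)) := ⟨_, rfl⟩
  obtain ⟨Mtcl, hMtcl⟩ : ∃ T : BondL2K ℂ d (towerP L m (n + 1)) c₀ W →L[ℂ] SiteL2K ℂ d (towerP L m (n + 1)) c₀ W,
      T = LinearMap.toContinuousLinearMap (covDivL2K ℂ c₀ ((η : ℂ))⁻¹ (adTransportW φ fun bb => (U bb)⁻¹) ∘ₗ hessOp φ η U τ) := ⟨_, rfl⟩
  obtain ⟨Gpcl, hGpcl⟩ : ∃ T : SiteL2K ℂ d (towerP L m (n + 1)) c₀ W →L[ℂ] SiteL2K ℂ d (towerP L m (n + 1)) c₀ W,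
      T = LinearMap.toContinuousLinearMap (GpOfUk L m n φ η U a' (c₁ := c₁) hpos') := ⟨_, rfl⟩
  obtain ⟨Rcl, hRcl⟩ : ∃ T : SiteL2K ℂ d (towerP L m (n + 1)) c₀ W →L[ℂ] SiteL2K ℂ d (towerP L m (n + 1)) c₀ W,
      T = LinearMap.toContinuousLinearMap (RofUk L m n φ η U (c₀ := c₀)) := ⟨_, rfl⟩
  have eG0 : ∀ g, G0cl g = G1k L m n φ η U hL αU hα1 hU1 hreg τ (c₀ := c₀) (c₁ := c₁) hpos g := fun g => by
    rw [hG0cl, LinearMap.coe_toContinuousLinearMap']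
  have eD : ∀ s, Dcl s = covDerivL2K ℂ c₀ ((η : ℂ))⁻¹ (adTransportW φ U) s := fun s => by rw [hDcl, LinearMap.coe_toContinuousLinearMap']
  have eDs : ∀ g, Dscl g = covDivL2K ℂ c₀ ((η : ℂ))⁻¹ (adTransportW φ fun bb => (U bb)⁻¹) g := fun g => by
    rw [hDscl, LinearMap.coe_toContinuousLinearMap']
  have eM : ∀ s, Mcl s = hessOp φ η U τ (covDerivL2K ℂ c₀ ((η : ℂ))⁻¹ (adTransportW φ U) s) := fun s => by
    rw [hMcl, LinearMap.coe_toContinuousLinearMap', LinearMap.comp_apply]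
  have eMt : ∀ g, Mtcl g = covDivL2K ℂ c₀ ((η : ℂ))⁻¹ (adTransportW φ fun bb => (U bb)⁻¹) (hessOp φ η U τ g) := fun g => by
    rw [hMtcl, LinearMap.coe_toContinuousLinearMap', LinearMap.comp_apply]
  have eGp : ∀ s, Gpcl s = GpOfUk L m n φ η U a' (c₁ := c₁) hpos' s := fun s => by rw [hGpcl, LinearMap.coe_toContinuousLinearMap']
  have eR : ∀ s, Rcl s = RofUk L m n φ η U (c₀ := c₀) s := fun s => by rw [hRcl, LinearMap.coe_toContinuousLinearMap']
  -- the three identities, read on the continuous linear maps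
  have hT' : ∀ g, Gt g = G0cl g + G0cl (Mcl (Gpcl (Rcl (Dscl (Gt g))))) + G0cl (Dcl (Rcl (Gpcl (Mtcl (Gt g - Dcl (Gpcl (Rcl (Dscl (Gt g))))))))) := by
    intro g; simp only [eG0, eD, eDs, eM, eMt, eGp, eR]; exact hT g
  have h2' : ∀ s, G0cl (Dcl (Rcl s)) = Dcl (Gpcl (Rcl s)) - G0cl (Mcl (Gpcl (Rcl s))) := by
    intro s; simp only [eG0, eD, eM, eGp, eR]; exact h2 s
  have h3' : ∀ s, Dscl (Dcl (Gpcl (Rcl s))) = Rcl s := by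
    intro s; simp only [eD, eDs, eGp, eR]; exact h3 s
  -- the eight letters at the common rate `κ`
  have hG0L : ∀ (v : TSite d m) (g : BondL2K ℂ d (towerP L m (n + 1)) c₀ W) (F : ℝ),
      (∀ x, blockCoord (L ^ (n + 1)) m (siteCast (towerP_eq_fineP_pow L m (n + 1)) (bpos x)) ≠ v →
        WL2.equiv ℂ (fun _ : Bond d (towerP L m (n + 1)) => c₀) W g x = 0) →
      (∀ x, ‖WL2.equiv ℂ (fun _ : Bond d (towerP L m (n + 1)) => c₀) W g x‖ ≤ F) →
      ∀ x, ‖WL2.equiv ℂ (fun _ : Bond d (towerP L m (n + 1)) => c₀) W (G0cl g) x‖ ≤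
        BK * Real.exp (-(κ * tdist m (blockCoord (L ^ (n + 1)) m (siteCast (towerP_eq_fineP_pow L m (n + 1)) (bpos x))) v)) * F := by
    intro v g F hgv hgF x
    have hF : 0 ≤ F := (norm_nonneg _).trans (hgF x)
    rw [eG0]
    exact (HK n η hηL c₀ c₁ hw hρ m hm U αU hα0 hα1 hU1 hreg εU hεU hUε hLb α hα hαK_ hUst hUb hUη hpl hUgrad hRlev hεg hAQ hpos' hpos v g F hgv hgF x).trans
      (mul_le_mul_of_nonneg_right (mul_le_mul_of_nonneg_left (exp_weaken' hκK (tdist_nonneg m _ _)) hBK) hF)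
  have hDsG0L : ∀ (v : TSite d m) (g : BondL2K ℂ d (towerP L m (n + 1)) c₀ W) (F : ℝ),
      (∀ x, blockCoord (L ^ (n + 1)) m (siteCast (towerP_eq_fineP_pow L m (n + 1)) (bpos x)) ≠ v →
        WL2.equiv ℂ (fun _ : Bond d (towerP L m (n + 1)) => c₀) W g x = 0) →
      (∀ x, ‖WL2.equiv ℂ (fun _ : Bond d (towerP L m (n + 1)) => c₀) W g x‖ ≤ F) →
      ∀ x, ‖WL2.equiv ℂ (fun _ : TSite d (towerP L m (n + 1)) => c₀) W (Dscl (G0cl g)) x‖ ≤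
        BG1 * Real.exp (-(κ * tdist m (blockCoord (L ^ (n + 1)) m (siteCast (towerP_eq_fineP_pow L m (n + 1)) x)) v)) * F := by
    intro v g F hgv hgF x
    have hF : 0 ≤ F := (norm_nonneg _).trans (hgF b)
    rw [eDs, eG0]
    exact (HG n η hηL c₀ c₁ hw hρ m hm U αU hα0 hα1 hU1 hreg εU hεU hUε hLb α hα hαG_ hUst hUb hUη hpl hUgrad hRlev hεg hAQ hpos' hpos v g F hgv hgF x).trans
      (mul_le_mul_of_nonneg_right (mul_le_mul_of_nonneg_left (exp_weaken' hκG (tdist_nonneg m _ _)) hBG1) hF)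
  have hGpL : ∀ (v : TSite d m) (s : SiteL2K ℂ d (towerP L m (n + 1)) c₀ W) (F : ℝ),
      (∀ x, blockCoord (L ^ (n + 1)) m (siteCast (towerP_eq_fineP_pow L m (n + 1)) x) ≠ v →
        WL2.equiv ℂ (fun _ : TSite d (towerP L m (n + 1)) => c₀) W s x = 0) →
      (∀ x, ‖WL2.equiv ℂ (fun _ : TSite d (towerP L m (n + 1)) => c₀) W s x‖ ≤ F) →
      ∀ x, ‖WL2.equiv ℂ (fun _ : TSite d (towerP L m (n + 1)) => c₀) W (Gpcl s) x‖ ≤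
        BR * Real.exp (-(κ * tdist m (blockCoord (L ^ (n + 1)) m (siteCast (towerP_eq_fineP_pow L m (n + 1)) x)) v)) * F := by
    intro v s F hsv hsF x
    have hF : 0 ≤ F := (norm_nonneg _).trans (hsF x)
    rw [eGp]
    exact (HR n η hηL c₀ c₁ hw hρ m hm U αU hα0 hα1 hU1 hreg εU hεU hUε hLb α hα hαR_ hUst hUb hUη hpl hUgrad hRlev hεg hAQ hpos' v s F hsv hsF x).1.trans
      (mul_le_mul_of_nonneg_right (mul_le_mul_of_nonneg_left (exp_weaken' hκR (tdist_nonneg m _ _)) hBR) hF)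
  have hRL : ∀ (v : TSite d m) (s : SiteL2K ℂ d (towerP L m (n + 1)) c₀ W) (F : ℝ),
      (∀ x, blockCoord (L ^ (n + 1)) m (siteCast (towerP_eq_fineP_pow L m (n + 1)) x) ≠ v →
        WL2.equiv ℂ (fun _ : TSite d (towerP L m (n + 1)) => c₀) W s x = 0) →
      (∀ x, ‖WL2.equiv ℂ (fun _ : TSite d (towerP L m (n + 1)) => c₀) W s x‖ ≤ F) →
      ∀ x, ‖WL2.equiv ℂ (fun _ : TSite d (towerP L m (n + 1)) => c₀) W (Rcl s) x‖ ≤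
        BR * Real.exp (-(κ * tdist m (blockCoord (L ^ (n + 1)) m (siteCast (towerP_eq_fineP_pow L m (n + 1)) x)) v)) * F := by
    intro v s F hsv hsF x
    have hF : 0 ≤ F := (norm_nonneg _).trans (hsF x)
    rw [eR]
    exact (HR n η hηL c₀ c₁ hw hρ m hm U αU hα0 hα1 hU1 hreg εU hεU hUε hLb α hα hαR_ hUst hUb hUη hpl hUgrad hRlev hεg hAQ hpos' v s F hsv hsF x).2.1.trans
      (mul_le_mul_of_nonneg_right (mul_le_mul_of_nonneg_left (exp_weaken' hκR (tdist_nonneg m _ _)) hBR) hF)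
  have hDGRL : ∀ (v : TSite d m) (s : SiteL2K ℂ d (towerP L m (n + 1)) c₀ W) (F : ℝ),
      (∀ x, blockCoord (L ^ (n + 1)) m (siteCast (towerP_eq_fineP_pow L m (n + 1)) x) ≠ v →
        WL2.equiv ℂ (fun _ : TSite d (towerP L m (n + 1)) => c₀) W s x = 0) →
      (∀ x, ‖WL2.equiv ℂ (fun _ : TSite d (towerP L m (n + 1)) => c₀) W s x‖ ≤ F) →
      ∀ x, ‖WL2.equiv ℂ (fun _ : Bond d (towerP L m (n + 1)) => c₀) W (Dcl (Gpcl (Rcl s))) x‖ ≤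
        BDb * Real.exp (-(κ * tdist m (blockCoord (L ^ (n + 1)) m (siteCast (towerP_eq_fineP_pow L m (n + 1)) (bpos x))) v)) * F := by
    intro v s F hsv hsF x
    have hF : 0 ≤ F := (norm_nonneg _).trans (hsF b.1)
    rw [eD, eGp, eR]
    have h := HD n η hηL c₀ c₁ hw hρ m hm U αU hα0 hα1 hU1 hreg εU hεU hUε hLb α hα hαD_ hUst hUb hUη hpl hUgrad hRlev hεg hAQ hpos' v s F hsv hsF x
    have htri : tdist m (blockCoord (L ^ (n + 1)) m (siteCast (towerP_eq_fineP_pow L m (n + 1)) (bpos x))) v ≤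
        tdist m (blockCoord (L ^ (n + 1)) m (siteCast (towerP_eq_fineP_pow L m (n + 1)) (btgt x))) v + 1 := by
      have h1 := tdist_triangle hm (blockCoord (L ^ (n + 1)) m (siteCast (towerP_eq_fineP_pow L m (n + 1)) (bpos x)))
        (blockCoord (L ^ (n + 1)) m (siteCast (towerP_eq_fineP_pow L m (n + 1)) (btgt x))) v
      have h2 := tdist_bigBlock_bpos_btgt_le_one L m (n + 1) hm x
      linarith only [h1, h2]
    calc _ ≤ BD * Real.exp (-(δD * tdist m (blockCoord (L ^ (n + 1)) m (siteCast (towerP_eq_fineP_pow L m (n + 1)) (btgt x))) v)) * F := h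
      _ ≤ BD * Real.exp (-(κ * tdist m (blockCoord (L ^ (n + 1)) m (siteCast (towerP_eq_fineP_pow L m (n + 1)) (btgt x))) v)) * F :=
          mul_le_mul_of_nonneg_right (mul_le_mul_of_nonneg_left (exp_weaken' hκD (tdist_nonneg m _ _)) hBD) hF
      _ ≤ BD * (Real.exp κ * Real.exp (-(κ * tdist m (blockCoord (L ^ (n + 1)) m (siteCast (towerP_eq_fineP_pow L m (n + 1)) (bpos x))) v))) * F :=
          mul_le_mul_of_nonneg_right (mul_le_mul_of_nonneg_left (exp_reblock hκ0.le htri) hBD) hF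
      _ = BDb * Real.exp (-(κ * tdist m (blockCoord (L ^ (n + 1)) m (siteCast (towerP_eq_fineP_pow L m (n + 1)) (bpos x))) v)) * F := by
          rw [hBDb]; ring
  have hML : ∀ (v : TSite d m) (s : SiteL2K ℂ d (towerP L m (n + 1)) c₀ W) (F : ℝ),
      (∀ x, blockCoord (L ^ (n + 1)) m (siteCast (towerP_eq_fineP_pow L m (n + 1)) x) ≠ v →
        WL2.equiv ℂ (fun _ : TSite d (towerP L m (n + 1)) => c₀) W s x = 0) →
      (∀ x, ‖WL2.equiv ℂ (fun _ : TSite d (towerP L m (n + 1)) => c₀) W s x‖ ≤ F) →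
      ∀ x, ‖WL2.equiv ℂ (fun _ : Bond d (towerP L m (n + 1)) => c₀) W (Mcl s) x‖ ≤
        (2 * Mφ * Mφ' * j₀ * Real.exp κ) *
          Real.exp (-(κ * tdist m (blockCoord (L ^ (n + 1)) m (siteCast (towerP_eq_fineP_pow L m (n + 1)) (bpos x))) v)) * F := by
    intro v s F hsv hsF x
    rw [eM]
    exact local_hessOp_covDerivL2K_tower L m (n + 1) φ τ hτ₂ hφτ hη hUst hc₀η hUb hMφ hMφ' hφ hφ' hJ hm hκ0.le v s F hsv hsF x
  have hMtL : ∀ (v : TSite d m) (g : BondL2K ℂ d (towerP L m (n + 1)) c₀ W) (F : ℝ),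
      (∀ x, blockCoord (L ^ (n + 1)) m (siteCast (towerP_eq_fineP_pow L m (n + 1)) (bpos x)) ≠ v →
        WL2.equiv ℂ (fun _ : Bond d (towerP L m (n + 1)) => c₀) W g x = 0) →
      (∀ x, ‖WL2.equiv ℂ (fun _ : Bond d (towerP L m (n + 1)) => c₀) W g x‖ ≤ F) →
      ∀ x, ‖WL2.equiv ℂ (fun _ : TSite d (towerP L m (n + 1)) => c₀) W (Mtcl g) x‖ ≤
        (2 * d * Mφ * Mφ' * j₀ * Real.exp κ) *
          Real.exp (-(κ * tdist m (blockCoord (L ^ (n + 1)) m (siteCast (towerP_eq_fineP_pow L m (n + 1)) x)) v)) * F := by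
    intro v g F hgv hgF x
    rw [eMt]
    exact local_covDivL2K_hessOp_tower L m (n + 1) φ τ hτ₂ hφτ hη hUst hc₀η hUb hMφ hMφ' hφ hφ' hJ hm hκ0.le v g F hgv hgF x
  have hSL : ∀ w' : TSite d m, ∑ u : TSite d m, Real.exp (-((κ - κ / 2) * tdist m w' u)) ≤ K := fun w' => by
    rw [hKdef]; exact torusSum_le d hm (sub_pos.2 (half_lt_self hκ0)) w'
  have hε₁0 : 0 ≤ 2 * Mφ * Mφ' * j₀ * Real.exp κ :=
    mul_nonneg (mul_nonneg (mul_nonneg (mul_nonneg zero_le_two hMφ) hMφ') hj₀0) (Real.exp_nonneg _)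
  have hε₂0 : 0 ≤ 2 * d * Mφ * Mφ' * j₀ * Real.exp κ :=
    mul_nonneg (mul_nonneg (mul_nonneg (mul_nonneg (mul_nonneg zero_le_two (Nat.cast_nonneg d)) hMφ) hMφ') hj₀0) (Real.exp_nonneg _)
  -- the two contraction factors are `≤ 1∕2` inside the current window
  have hsq : j₀ ^ 2 ≤ j₀ := by rw [sq]; exact mul_le_of_le_one_right hj₀0 hj₀1
  have hq₁ : BR * K * BR * K * (2 * Mφ * Mφ' * j₀ * Real.exp κ) * K * BK * K + (2 * d * Mφ * Mφ' * j₀ * Real.exp κ) * K * BR * K * BDb * K +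
      BDb * K * (2 * d * Mφ * Mφ' * j₀ * Real.exp κ) * K * BR * K * BDb * K +
      (2 * d * Mφ * Mφ' * j₀ * Real.exp κ) * K * BR * K * BR * K * BR * K * (2 * Mφ * Mφ' * j₀ * Real.exp κ) * K * BK * K +
      BDb * K * (2 * d * Mφ * Mφ' * j₀ * Real.exp κ) * K * BR * K * BR * K * BR * K * (2 * Mφ * Mφ' * j₀ * Real.exp κ) * K * BK * K ≤ 1 / 2 := by
    have e : BR * K * BR * K * (2 * Mφ * Mφ' * j₀ * Real.exp κ) * K * BK * K + (2 * d * Mφ * Mφ' * j₀ * Real.exp κ) * K * BR * K * BDb * K +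
        BDb * K * (2 * d * Mφ * Mφ' * j₀ * Real.exp κ) * K * BR * K * BDb * K +
        (2 * d * Mφ * Mφ' * j₀ * Real.exp κ) * K * BR * K * BR * K * BR * K * (2 * Mφ * Mφ' * j₀ * Real.exp κ) * K * BK * K +
        BDb * K * (2 * d * Mφ * Mφ' * j₀ * Real.exp κ) * K * BR * K * BR * K * BR * K * (2 * Mφ * Mφ' * j₀ * Real.exp κ) * K * BK * K =
        j₀ * A₁ + j₀ ^ 2 * A₂ := by
      rw [hA₁, hA₂, he1, he2]; ring
    rw [e]
    calc j₀ * A₁ + j₀ ^ 2 * A₂ ≤ j₀ * A₁ + j₀ * A₂ := add_le_add le_rfl (mul_le_mul_of_nonneg_right hsq hA₂0)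
      _ = j₀ * (A₁ + A₂) := by ring
      _ ≤ j₁ * S := mul_le_mul hj (by rw [hS]; linarith only [hA₃0, hA₄0]) (add_nonneg hA₁0 hA₂0) hj₁0.le
      _ ≤ 1 / 2 := hj₁S
  have hq₂ : BR * K * BR * K * (2 * Mφ * Mφ' * j₀ * Real.exp κ) * K * BG1 * K + (2 * d * Mφ * Mφ' * j₀ * Real.exp κ) * K * BR * K * BR * K +
      BDb * K * (2 * d * Mφ * Mφ' * j₀ * Real.exp κ) * K * BR * K * BR * K +
      (2 * d * Mφ * Mφ' * j₀ * Real.exp κ) * K * BR * K * BR * K * BR * K * (2 * Mφ * Mφ' * j₀ * Real.exp κ) * K * BG1 * K +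
      BDb * K * (2 * d * Mφ * Mφ' * j₀ * Real.exp κ) * K * BR * K * BR * K * BR * K * (2 * Mφ * Mφ' * j₀ * Real.exp κ) * K * BG1 * K ≤ 1 / 2 := by
    have e : BR * K * BR * K * (2 * Mφ * Mφ' * j₀ * Real.exp κ) * K * BG1 * K + (2 * d * Mφ * Mφ' * j₀ * Real.exp κ) * K * BR * K * BR * K +
        BDb * K * (2 * d * Mφ * Mφ' * j₀ * Real.exp κ) * K * BR * K * BR * K +
        (2 * d * Mφ * Mφ' * j₀ * Real.exp κ) * K * BR * K * BR * K * BR * K * (2 * Mφ * Mφ' * j₀ * Real.exp κ) * K * BG1 * K +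
        BDb * K * (2 * d * Mφ * Mφ' * j₀ * Real.exp κ) * K * BR * K * BR * K * BR * K * (2 * Mφ * Mφ' * j₀ * Real.exp κ) * K * BG1 * K =
        j₀ * A₃ + j₀ ^ 2 * A₄ := by
      rw [hA₃, hA₄, he1, he2]; ring
    rw [e]
    calc j₀ * A₃ + j₀ ^ 2 * A₄ ≤ j₀ * A₃ + j₀ * A₄ := add_le_add le_rfl (mul_le_mul_of_nonneg_right hsq hA₄0)
      _ = j₀ * (A₃ + A₄) := by ring
      _ ≤ j₁ * S := mul_le_mul hj (by rw [hS]; linarith only [hA₁0, hA₂0]) (add_nonneg hA₃0 hA₄0) hj₁0.le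
      _ ≤ 1 / 2 := hj₁S
  -- (K72)
  have hpair := transfer_pair (𝕜 := ℂ) (tdist m)
    (fun x : Bond d (towerP L m (n + 1)) => blockCoord (L ^ (n + 1)) m (siteCast (towerP_eq_fineP_pow L m (n + 1)) (bpos x)))
    (fun x : TSite d (towerP L m (n + 1)) => blockCoord (L ^ (n + 1)) m (siteCast (towerP_eq_fineP_pow L m (n + 1)) x))
    G0cl Gt Dcl Mcl Dscl Mtcl Gpcl Rcl (tdist_nonneg m) (fun u y' w' => tdist_triangle hm u y' w') hT' h2' h3'
    hBK hBG1 hBR hBR hBDb0 hε₁0 hε₂0 (half_pos hκ0).le (half_lt_self hκ0) hG0L hDsG0L hGpL hRL hDGRL hML hMtL hSL _ _ rfl rfl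
    (lt_of_le_of_lt hq₁ (by norm_num)) (lt_of_le_of_lt hq₂ (by norm_num))
  -- the constant: `max B₀ B₁ ∕ (1 − max q₁ q₂) ≤ 2·max B₀ B₁`
  have hmaxq : max (BR * K * BR * K * (2 * Mφ * Mφ' * j₀ * Real.exp κ) * K * BK * K + (2 * d * Mφ * Mφ' * j₀ * Real.exp κ) * K * BR * K * BDb * K +
      BDb * K * (2 * d * Mφ * Mφ' * j₀ * Real.exp κ) * K * BR * K * BDb * K +
      (2 * d * Mφ * Mφ' * j₀ * Real.exp κ) * K * BR * K * BR * K * BR * K * (2 * Mφ * Mφ' * j₀ * Real.exp κ) * K * BK * K +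
      BDb * K * (2 * d * Mφ * Mφ' * j₀ * Real.exp κ) * K * BR * K * BR * K * BR * K * (2 * Mφ * Mφ' * j₀ * Real.exp κ) * K * BK * K)
      (BR * K * BR * K * (2 * Mφ * Mφ' * j₀ * Real.exp κ) * K * BG1 * K + (2 * d * Mφ * Mφ' * j₀ * Real.exp κ) * K * BR * K * BR * K +
      BDb * K * (2 * d * Mφ * Mφ' * j₀ * Real.exp κ) * K * BR * K * BR * K +
      (2 * d * Mφ * Mφ' * j₀ * Real.exp κ) * K * BR * K * BR * K * BR * K * (2 * Mφ * Mφ' * j₀ * Real.exp κ) * K * BG1 * K +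
      BDb * K * (2 * d * Mφ * Mφ' * j₀ * Real.exp κ) * K * BR * K * BR * K * BR * K * (2 * Mφ * Mφ' * j₀ * Real.exp κ) * K * BG1 * K) ≤ 1 / 2 :=
    max_le hq₁ hq₂
  have hB0 : 0 ≤ max BK BG1 := hBK.trans (le_max_left _ _)
  have hconst : ∀ {q : ℝ}, q ≤ 1 / 2 → max BK BG1 / (1 - q) ≤ 2 * max BK BG1 := fun {q} hq => by
    have h1 : (1 : ℝ) / 2 ≤ 1 - q := by linarith only [hq]
    calc max BK BG1 / (1 - q) ≤ max BK BG1 / (1 / 2) := div_le_div_of_nonneg_left hB0 (by norm_num) h1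
      _ = 2 * max BK BG1 := by ring
  refine ⟨?_, ?_⟩
  · exact (hpair.1 v f F hfv hfF b).trans (mul_le_mul_of_nonneg_right (mul_le_mul_of_nonneg_right (hconst hmaxq) (Real.exp_nonneg _)) hF0)
  · have h := hpair.2 v f F hfv hfF y
    rw [eDs] at h
    exact h.trans (mul_le_mul_of_nonneg_right (mul_le_mul_of_nonneg_right (hconst hmaxq) (Real.exp_nonneg _)) hF0)

end Literature.MathematicalPhysics.QuantumFieldTheory.Balaban1983to89.B9Eq3130GtildePairRowsClosed

end
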